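import Summits.MatrixMultiplication.OmegaCensus.SmallFormats.MatMul22nRankGF7PatternDFS
import HarnessLib

/-!
# ω-census family (a): dot products of digit vectors by ONE multiplication (kernel arithmetic for the slack-4 search)

Cell `pub-omega` (unit `pub-omega-tensor-g15`), topic `Summits/MatrixMultiplication/OmegaCensus` (sub-folder `SmallFormats`).
Framing (verbatim): lottery ticket; floor = certified bounds/negative ranges. HONEST FRAMING: kernel infrastructure for step S1 of
`pub-omega-tensor-g15/KERNEL-S4-DESIGN.md` (§3, §6 route (c)); nothing here is progress on `ω`.

`pack10 f n = Σ_{i<n} f i · 2^(10 i)`. If `p i ≤ 4` and `l i ≤ 6` (`i < n ≤ 42`), the product `pack10 p n * pack10 (reverse of l) n` has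
base-`2^10` digits the convolution coefficients, all `< 2^10`, and its digit `n − 1` is the dot product `Σ_{i<n} p i · l i` (`dot_digit10`).
So the Lean kernel (GMP multiplication on literals) evaluates a 42-term dot product of a packed pattern with a packed functional in a handful
of reduction steps (`dotPack10`), which is what the bucket-key and coordinate-determination steps of the search need.
-/

namespace Summit.MatrixMultiplication.OmegaCensus.SmallFormats

open Finset

/-- Base-`2^10` packing of the first `n` values of `f`. -/
def pack10 (f : ℕ → ℕ) (n : ℕ) : ℕ := ∑ i ∈ range n, f i * 2 ^ (10 * i)

/-- The low part of a packing is below the next power of the base. -/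
theorem pack10_lt (f : ℕ → ℕ) (n : ℕ) (hf : ∀ i < n, f i < 2 ^ 10) : pack10 f n < 2 ^ (10 * n) := by
  induction n with
  | zero => simp [pack10]
  | succ n ih =>
    have h1 := ih fun i hi => hf i (by omega)
    have h3 : f n * 2 ^ (10 * n) ≤ (2 ^ 10 - 1) * 2 ^ (10 * n) :=
      Nat.mul_le_mul_right _ (by have := hf n (by omega); omega)
    have h4 : (2 ^ 10 - 1) * 2 ^ (10 * n) + 2 ^ (10 * n) = 2 ^ (10 * (n + 1)) := by
      rw [show 10 * (n + 1) = 10 + 10 * n by ring, pow_add]; norm_num; ring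
    unfold pack10 at h1 ⊢; rw [sum_range_succ]; omega

/-- Splitting a packing at position `j < n`. -/
theorem pack10_split (f : ℕ → ℕ) {n j : ℕ} (hj : j < n) :
    pack10 f n = pack10 f j + f j * 2 ^ (10 * j) + 2 ^ (10 * (j + 1)) * ∑ i ∈ range (n - (j + 1)), f (j + 1 + i) * 2 ^ (10 * i) := by
  unfold pack10
  have hn : n = (j + 1) + (n - (j + 1)) := by omega
  conv_lhs => rw [hn, sum_range_add, sum_range_succ]
  congr 1
  rw [mul_sum]
  refine sum_congr rfl fun i _ => ?_
  rw [show 10 * (j + 1 + i) = 10 * (j + 1) + 10 * i by ring, pow_add]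
  ring

/-- **Digit extraction** for `pack10`. -/
theorem pack10_digit (f : ℕ → ℕ) {n : ℕ} (hf : ∀ i < n, f i < 2 ^ 10) {j : ℕ} (hj : j < n) :
    pack10 f n / 2 ^ (10 * j) % 2 ^ 10 = f j := by
  rw [pack10_split f hj]
  have hlow : pack10 f j < 2 ^ (10 * j) := pack10_lt f j fun i hi => hf i (by omega)
  set C := ∑ i ∈ range (n - (j + 1)), f (j + 1 + i) * 2 ^ (10 * i) with hC
  have hpos : 0 < 2 ^ (10 * j) := Nat.two_pow_pos _
  have e1 : (pack10 f j + f j * 2 ^ (10 * j) + 2 ^ (10 * (j + 1)) * C) / 2 ^ (10 * j) = f j + 2 ^ 10 * C := by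
    rw [show 2 ^ (10 * (j + 1)) * C = (2 ^ 10 * C) * 2 ^ (10 * j) by
      rw [show 10 * (j + 1) = 10 * j + 10 by ring, pow_add]; ring]
    rw [add_assoc, ← add_mul, Nat.add_mul_div_right _ _ hpos, Nat.div_eq_of_lt hlow, zero_add]
  rw [e1, Nat.add_mul_mod_self_left, Nat.mod_eq_of_lt (hf j hj)]

/-- `fld 10` reads base-`2^10` digits. -/
theorem fld10_eq (N z : ℕ) : fld 10 N z = N / 2 ^ (10 * z) % 2 ^ 10 := by
  unfold fld; rw [Nat.and_two_pow_sub_one_eq_mod, Nat.shiftRight_eq_div_pow]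

/-- Convolution coefficient `k` of two length-`n` digit vectors. -/
def conv10 (p l : ℕ → ℕ) (n k : ℕ) : ℕ := ∑ x ∈ (range n ×ˢ range n).filter (fun x => x.1 + x.2 = k), p x.1 * l x.2

/-- **Product of packings = packing of the convolution** (as numbers; no digit bound needed). -/
theorem pack10_mul (p l : ℕ → ℕ) (n : ℕ) : pack10 p n * pack10 l n = ∑ k ∈ range (2 * n), conv10 p l n k * 2 ^ (10 * k) := by
  unfold pack10 conv10
  rw [sum_mul_sum, ← sum_product']
  -- right side: fibrewise over k = i + j
  have hmaps : ∀ x ∈ range n ×ˢ range n, x.1 + x.2 ∈ range (2 * n) := by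
    intro x hx; rw [mem_product, mem_range, mem_range] at hx; rw [mem_range]; omega
  rw [← sum_fiberwise_of_maps_to hmaps]
  refine sum_congr rfl fun k _ => ?_
  rw [sum_mul]
  refine sum_congr rfl fun x hx => ?_
  rw [mem_filter] at hx
  rw [← hx.2, show 10 * (x.1 + x.2) = 10 * x.1 + 10 * x.2 by ring, pow_add]
  ring

/-- Bound on the convolution coefficients: at most `n` terms, each `≤ 4·6`. -/
theorem conv10_le (p l : ℕ → ℕ) (n k : ℕ) (hp : ∀ i < n, p i ≤ 4) (hl : ∀ i < n, l i ≤ 6) : conv10 p l n k ≤ n * 24 := by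
  unfold conv10
  set S := (range n ×ˢ range n).filter (fun x => x.1 + x.2 = k) with hS
  have hcard : S.card ≤ n := by
    have hinj : Set.InjOn (fun x : ℕ × ℕ => x.1) ↑S := by
      intro x hx y hy hxy
      have hx' := (mem_filter.1 (Finset.mem_coe.1 hx)).2
      have hy' := (mem_filter.1 (Finset.mem_coe.1 hy)).2
      ext
      · exact hxy
      · simp only at hxy; omega
    have himg : S.image (fun x : ℕ × ℕ => x.1) ⊆ range n := by
      intro a ha; rw [mem_image] at ha; obtain ⟨x, hx, rfl⟩ := ha
      exact (mem_product.1 (mem_filter.1 hx).1).1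
    calc S.card = (S.image fun x : ℕ × ℕ => x.1).card := (card_image_of_injOn hinj).symm
      _ ≤ (range n).card := card_le_card himg
      _ = n := card_range n
  calc ∑ x ∈ S, p x.1 * l x.2 ≤ ∑ x ∈ S, 24 := by
        refine sum_le_sum fun x hx => ?_
        have hx' := mem_product.1 (mem_filter.1 hx).1
        exact Nat.mul_le_mul (hp _ (mem_range.1 hx'.1)) (by have := hl _ (mem_range.1 hx'.2); omega)
    _ = S.card * 24 := by rw [sum_const, smul_eq_mul]
    _ ≤ n * 24 := Nat.mul_le_mul_right _ hcard

/-- The middle convolution coefficient with the reversed second vector is the dot product. -/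
theorem conv10_rev (p l : ℕ → ℕ) {n : ℕ} (hn : 0 < n) :
    conv10 p (fun i => l (n - 1 - i)) n (n - 1) = ∑ i ∈ range n, p i * l i := by
  unfold conv10
  -- the fibre over n-1 is the graph i ↦ (i, n-1-i)
  have e : (range n ×ˢ range n).filter (fun x : ℕ × ℕ => x.1 + x.2 = n - 1) = (range n).image fun i => (i, n - 1 - i) := by
    ext x
    rw [mem_filter, mem_product, mem_range, mem_range, mem_image]
    constructor
    · rintro ⟨⟨h1, _⟩, h3⟩; exact ⟨x.1, mem_range.2 h1, by ext <;> simp; omega⟩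
    · rintro ⟨i, hi, rfl⟩; have := mem_range.1 hi; refine ⟨⟨this, ?_⟩, ?_⟩ <;> simp <;> omega
  rw [e, sum_image (fun i _ j _ h => by simpa using congrArg Prod.fst h)]
  refine sum_congr rfl fun i hi => ?_
  have := mem_range.1 hi
  simp only
  rw [show n - 1 - (n - 1 - i) = i by omega]

/-- **Dot product as a digit.** For `p i ≤ 4`, `l i ≤ 6` (`i < n`, `0 < n ≤ 42`): digit `n − 1` (base `2^10`) of
`pack10 p n * pack10 (i ↦ l (n−1−i)) n` is `Σ_{i<n} p i · l i`. -/
theorem dot_digit10 (p l : ℕ → ℕ) {n : ℕ} (hn : 0 < n) (hn42 : n ≤ 42) (hp : ∀ i < n, p i ≤ 4) (hl : ∀ i < n, l i ≤ 6) :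
    fld 10 (pack10 p n * pack10 (fun i => l (n - 1 - i)) n) (n - 1) = ∑ i ∈ range n, p i * l i := by
  rw [fld10_eq, pack10_mul]
  have hl' : ∀ i < n, (fun i => l (n - 1 - i)) i ≤ 6 := fun i hi => hl _ (by omega)
  have hbound : ∀ k < 2 * n, conv10 p (fun i => l (n - 1 - i)) n k < 2 ^ 10 :=
    fun k _ => lt_of_le_of_lt (conv10_le p _ n k hp hl') (by omega)
  have h := pack10_digit (conv10 p (fun i => l (n - 1 - i)) n) hbound (j := n - 1) (by omega)
  unfold pack10 at h
  rw [h, conv10_rev p l hn]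

/-- The kernel-side dot product: digit `41` of the product of a packed 42-vector with a packed reversed 42-vector. -/
def dotPack10 (P L : ℕ) : ℕ := fld 10 (P * L) 41

/-- **`dotPack10` computes dot products** of a pattern-like vector (`≤ 4`) with a coefficient vector (`≤ 6`), both of length `42`,
when given their packings (`L` packed in reverse). -/
theorem dotPack10_eq (p l : ℕ → ℕ) (hp : ∀ i < 42, p i ≤ 4) (hl : ∀ i < 42, l i ≤ 6) :
    dotPack10 (pack10 p 42) (pack10 (fun i => l (41 - i)) 42) = ∑ i ∈ range 42, p i * l i := by
  unfold dotPack10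
  have h := dot_digit10 p l (n := 42) (by norm_num) le_rfl hp hl
  exact h

end Summit.MatrixMultiplication.OmegaCensus.SmallFormats
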